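import Summits.HubbardSuperconductivity.HubbardSuperconductivity.Theorems.LevyLogBootstrapDressHalfFilledSectorEnergies
import Summits.HubbardSuperconductivity.HubbardSuperconductivity.Theorems.LevyLogBootstrapDressHalfFilledPairField
import HarnessLib

/-!
# Crux `DressHalfFilled` (stmt-HubbardSuperconductivity-8148, route `LevyLogBootstrap`; shared with route
# `AnisotropyChord`): `PlaquetteData U` for `U ∈ [2, 4]` REDUCED TO THE KATO-KERNEL WINDOW (stub 1 modulo (W1))

Support file (`--supports stmt-HubbardSuperconductivity-8148`) for STUB 1 of the line `Cruxes/DressHalfFilled/Lines/birth.lean`,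
`stub_plaquetteData : ∃ U > 0, PlaquetteData U` (verbatim `stub_kineticGlueInWindow` of
`Cruxes/DressAnyFilling/Lines/birth.lean`, crux stmt-HubbardSuperconductivity-10291 — one proof serves both cruxes).
`PlaquetteData U` is the conjunction of seven finite-dimensional clauses about ONE `2 × 2` Hubbard plaquette at `t = 1`:
(W1) the `O(t'²)` pair-boson couplings lie in the easy-plane window, `0 < J(U)`, `0 ≤ V(U) < 2J(U)`; (W2) the `B₁g`
selection rule `0 < c(U)`; (W3) pair binding, pair exclusion and the strict chord condition
`(4-n)E(2) + (n-2)E(4) < 2E(n)`, `n ∈ {0,…,8} ∖ {2,4}`; (W4) uniqueness of the `(4,0)` and `(2,0)` sector ground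
states; (W5) they lie strictly below the `S^z ≠ 0` sectors of their charge.

THIS FILE PROVES (W2)–(W5) FOR EVERY `U ∈ [2, 4]` from the CooperPairDMott certified exact diagonalisation of the
plaquette (`stub_plaquetteDWaveElement`, `stub_plaquettePairBinding`'s certificates, the sector floors `plaq{ab}_lb`)
and the two preceding support files (`…SectorFloors`, `…SectorEnergies`, `…PairField`), and assembles

  `plaquetteData_of_kernelWindow : U ∈ [2,4] → 0 < J(U) → 0 ≤ V(U) → V(U) < 2J(U) → PlaquetteData U`

(the conclusion written out verbatim — the `def PlaquetteData` lives in the non-importable skeleton), together with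
the existential form `stub_plaquetteData_of_kernelWindow : (∃ U ∈ [2,4], window) → ∃ U > 0, PlaquetteData U`, which
is LITERALLY stub 1 modulo its clause (W1). What remains of stub 1 is therefore exactly (W1) at one `U ∈ [2, 4]`:
a certified evaluation of Kato's second-order two-plaquette kernel `plaquetteKernel U` (`interClusterKernel`, a
`pairResolvent` double eigen-sum of the 256-dimensional plaquette Hamiltonian) — uncertified ED gives
`V/2J = 0.993` at `U = 2` (Yao–Tsai–Kivelson 2007, p. 4: `V/J < 2` exactly for `U < U_s ≈ 2.7`, so the admissible
sub-interval is `[2, U_s)`).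

* `plaquette_chordCondition` (W3, all nine chords by linear arithmetic from the sector-energy table),
  `plaquette_pairBinding_pos`, `plaquette_pairExclusion_pos`;
* `plaquette_pairGS_unique` (W4, charge 2: `stub_plaquetteDWaveElement`), `plaquette_vacuumGS_unique` (W4, charge 4:
  a nonvanishing linear functional — the certified `d`-wave matrix element — on the ground space forces dimension one);
* `plaquette_vacuum_below`, `plaquette_pair_below` (W5: sector floors `(3,1)`, `(1,3)`, `(4,0)`, `(0,4)` above `e₄⁰`,
  and the new `(2,0)`, `(0,2)` floor `-5/2` above `e₂⁰ ≤ ē₂(U) < -3.37`).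

Sources: W.-F. Tsai, S. A. Kivelson, PRB 73 (2006) 214510, Table I, App. A [TsaiKivelson2006]; H. Yao, W.-F. Tsai,
S. A. Kivelson, PRB 76 (2007) 161104(R), eq. (2), p. 4 [YaoTsaiKivelson2007]; E. H. Lieb, PRL 62 (1989) 1201 (W4–W5 at
half filling, here obtained by certificate instead). No definition and no named fact is introduced; sorry-free.
-/

noncomputable section

set_option linter.dupNamespace false

namespace Summit.HubbardSuperconductivity.HubbardSuperconductivity.Theorems.LevyLogBootstrap

open Matrix Finset Literature.MathematicalPhysics.QuantumLattice Literature.Probability.LatticeModels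
open Summit.HubbardSuperconductivity.HubbardSuperconductivity.Theorems.CooperPairDMottWalk
open scoped ComplexOrder

section Plaquette

variable {U : ℝ}

/-- `|PlaquetteSite| = 4`, as a rewriting aid. [folklore] -/
private theorem card4' : Fintype.card PlaquetteSite = 4 := card_plaquetteSite

/-! ### (W3) The strict chord condition, pair binding, pair exclusion -/

/-- **(W3) The strict chord condition on the plaquette charge, `U ∈ [2, 4]`**:
`(4 - n) E(2) + (n - 2) E(4) < 2 E(n)` for every `n ∈ {0,…,8} ∖ {2,4}` (`E(n) = groundEnergyAt plaquetteGraph 1 U n`)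
— the configurations with every plaquette carrying `2` or `4` electrons are the STRICT minimisers of decoupled
plaquettes at every admissible charge. Linear arithmetic from the certified sector-energy table of
`…SectorEnergies` (`n = 3` is pair binding, margins `0.01–0.03`; the other chords hold with margins `≥ 0.1`).
Tsai–Kivelson 2006, Table I; Yao–Tsai–Kivelson 2007, eq. (2). [folklore] -/
theorem plaquette_chordCondition (hU2 : 2 ≤ U) (hU4 : U ≤ 4) :
    ∀ n : ℕ, n ≤ 8 → n ≠ 2 → n ≠ 4 →
      (4 - (n : ℝ)) * groundEnergyAt plaquetteGraph 1 U 2 + ((n : ℝ) - 2) * groundEnergyAt plaquetteGraph 1 U 4 <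
        2 * groundEnergyAt plaquetteGraph 1 U n := by
  have h0 := plaquetteE0_ge (U := U) hU2
  have h1 := plaquetteE1_ge (U := U) hU2
  have h2l := plaquetteE2_ge (U := U) hU2
  have h2u := plaquetteE2_le U
  have h3 := plaquette_pairBinding (U := U) hU2 hU4
  have h4l := plaquetteE4_ge (U := U) hU2 hU4
  have h4u := plaquetteE4_le U
  have h5 := plaquetteE5_ge (U := U) hU2 hU4
  have h6 := plaquetteE6_ge (U := U) hU2 hU4
  have h7 := plaquetteE7_ge (U := U) hU2 hU4
  have h8 := plaquetteE8_ge (U := U) hU2 hU4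
  intro n hn hn2 hn4
  interval_cases n
  · norm_num; linarith
  · norm_num; linarith
  · exact absurd rfl hn2
  · norm_num; linarith
  · exact absurd rfl hn4
  · norm_num; linarith
  · norm_num; linarith
  · norm_num; linarith
  · norm_num; linarith

/-- **(W3) Pair binding**: `0 < Δ_p(U) = 2E(3 e) - E(4 e) - E(2 e)` for `U ∈ [2, 4]`
(`(plaquettePairCouplings U).pairBinding`, hole convention `E(Q holes) = E(4 - Q electrons)`).
Tsai–Kivelson 2006, eq. (2). [folklore] -/
theorem plaquette_pairBinding_pos (hU2 : 2 ≤ U) (hU4 : U ≤ 4) : 0 < (plaquettePairCouplings U).pairBinding := by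
  have h3 := plaquette_pairBinding (U := U) hU2 hU4
  show 0 < plaquettePairBinding U
  unfold plaquettePairBinding plaquetteEnergy
  norm_num
  linarith

/-- **(W3) Pair exclusion** (hard core): `0 < E(4 e) + E(0 e) - 2E(2 e)` for `U ∈ [2, 4]`
(`(plaquettePairCouplings U).pairExclusion`). Yao–Tsai–Kivelson 2007, eq. (2). [folklore] -/
theorem plaquette_pairExclusion_pos (hU2 : 2 ≤ U) (hU4 : U ≤ 4) :
    0 < (plaquettePairCouplings U).pairExclusion := by
  have h0 := plaquetteE0_ge (U := U) hU2
  have h2u := plaquetteE2_le U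
  have h4l := plaquetteE4_ge (U := U) hU2 hU4
  show 0 < plaquettePairExclusion U
  unfold plaquettePairExclusion plaquetteEnergy
  norm_num
  linarith

/-! ### (W4) Uniqueness of the two plaquette ground states -/

/-- **(W4, charge 2)**: the `(N, S^z) = (2, 0)` sector ground state of the plaquette is unique up to a scalar,
`U ∈ [2, 4]` (certified gap of the `(1,1)` sector form, `stub_plaquetteDWaveElement`). Tsai–Kivelson 2006,
Table I. [folklore] -/
theorem plaquette_pairGS_unique (hU : U ∈ Set.Icc (2 : ℝ) 4) :
    ∀ φ₁ φ₂ : Fock (Orb PlaquetteSite), IsGroundStateInSector (plaquetteHamiltonian U) 2 0 φ₁ →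
      IsGroundStateInSector (plaquetteHamiltonian U) 2 0 φ₂ → ∃ a : ℂ, φ₂ = a • φ₁ :=
  (stub_plaquetteDWaveElement U hU).1

/-- **(W4, charge 4)**: the half-filled `(4, 0)` sector ground state of the plaquette is unique up to a scalar,
`U ∈ [2, 4]`. The certified `d`-wave matrix element `φ₄ ↦ ⟨φ₂, Δ_d φ₄⟩` (`stub_plaquetteDWaveElement`, with
`φ₂ = plaquettePair U`) is a linear functional vanishing on NO ground state, so the ground space has no
two-dimensional subspace. (Lieb 1989, Theorem 2 gives the same for every `U > 0`; here by certificate.)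
[folklore] -/
theorem plaquette_vacuumGS_unique (hU : U ∈ Set.Icc (2 : ℝ) 4) :
    ∀ φ₁ φ₂ : Fock (Orb PlaquetteSite), IsGroundStateInSector (plaquetteHamiltonian U) 4 0 φ₁ →
      IsGroundStateInSector (plaquetteHamiltonian U) 4 0 φ₂ → ∃ a : ℂ, φ₂ = a • φ₁ := by
  intro φ₁ φ₂ h₁ h₂
  have hne := (stub_plaquetteDWaveElement U hU).2
  have hp := (plaquettePair_spec U).2
  set Δ := pairField dWaveFormFactor 2 with hΔ
  set c₁ : ℂ := star (plaquettePair U) ⬝ᵥ (Δ *ᵥ φ₁) with hc₁def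
  set c₂ : ℂ := star (plaquettePair U) ⬝ᵥ (Δ *ᵥ φ₂) with hc₂def
  have hc₁ : c₁ ≠ 0 := hne _ _ hp h₁
  by_contra hcon
  -- the combination with vanishing matrix element
  have hψ0 : c₂ • φ₁ - c₁ • φ₂ ≠ 0 := by
    intro h0
    apply hcon
    have h' : c₁ • φ₂ = c₂ • φ₁ := (sub_eq_zero.1 h0).symm
    refine ⟨c₁⁻¹ * c₂, ?_⟩
    calc φ₂ = c₁⁻¹ • (c₁ • φ₂) := by rw [smul_smul, inv_mul_cancel₀ hc₁, one_smul]
      _ = (c₁⁻¹ * c₂) • φ₁ := by rw [h', smul_smul]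
  have hψ : IsGroundStateInSector (plaquetteHamiltonian U) 4 0 (c₂ • φ₁ - c₁ • φ₂) := by
    refine ⟨Submodule.sub_mem _ (Submodule.smul_mem _ _ h₁.1) (Submodule.smul_mem _ _ h₂.1), hψ0, ?_⟩
    rw [mulVec_sub, mulVec_smul, mulVec_smul, h₁.2.2, h₂.2.2, smul_sub, smul_comm c₂, smul_comm c₁]
  have := hne _ _ hp hψ
  apply this
  show star (plaquettePair U) ⬝ᵥ (Δ *ᵥ (c₂ • φ₁ - c₁ • φ₂)) = 0
  rw [mulVec_sub, mulVec_smul, mulVec_smul, dotProduct_sub, dotProduct_smul, dotProduct_smul, smul_eq_mul,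
    smul_eq_mul, ← hc₁def, ← hc₂def]
  ring

/-! ### (W5) The singlet sectors lie strictly below their `S^z ≠ 0` partners -/

/-- **(W5, charge 4)**: `e(4, 0) < e(4, m)` for `m = ±1, ±2`, `U ∈ [2, 4]`: the sectors `(3,1)`, `(1,3)` are
certified at `≥ e₄⁰ + 1/20` (`plaq31_lb`, `plaq13_lb`) and `(4,0)`, `(0,4)` at `≥ 0 > ē₄(U) ≥ e₄⁰`. Tsai–Kivelson 2006,
Table I (spin gap `0.14–0.30`). [folklore] -/
theorem plaquette_vacuum_below (hU2 : 2 ≤ U) (hU4 : U ≤ 4) :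
    ∀ m : ℝ, m = 1 ∨ m = -1 ∨ m = 2 ∨ m = -2 →
      (plaquetteHamiltonian U).minEnergyOn (szSector 4 0) < (plaquetteHamiltonian U).minEnergyOn (szSector 4 m) := by
  have he4 := e4_le_0 U
  intro m hm
  rcases hm with rfl | rfl | rfl | rfl
  · have h := le_minEnergyOn_szSector_of_sectorBound plaquetteGraph 1 U _ (a := 3) (b := 1)
      (by rw [card4']; omega) (by rw [card4']; omega) (plaq31_lb hU2 hU4)
    have hs : (szSector (3 + 1) ((((3 : ℕ) : ℝ) - ((1 : ℕ) : ℝ)) / 2) :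
        Submodule ℂ (Fock (Orb PlaquetteSite))) = szSector 4 1 := by norm_num
    rw [hs, show hamiltonian plaquetteGraph 1 U = plaquetteHamiltonian U from rfl] at h
    linarith
  · have h := le_minEnergyOn_szSector_of_sectorBound plaquetteGraph 1 U _ (a := 1) (b := 3)
      (by rw [card4']; omega) (by rw [card4']; omega) (plaq13_lb hU2 hU4)
    have hs : (szSector (1 + 3) ((((1 : ℕ) : ℝ) - ((3 : ℕ) : ℝ)) / 2) :
        Submodule ℂ (Fock (Orb PlaquetteSite))) = szSector 4 (-1) := by norm_num
    rw [hs, show hamiltonian plaquetteGraph 1 U = plaquetteHamiltonian U from rfl] at h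
    linarith
  · have h := le_minEnergyOn_szSector_of_sectorBound plaquetteGraph 1 U _ (a := 4) (b := 0)
      (by rw [card4']) (by rw [card4']; omega) (plaq40_lb hU2)
    have hs : (szSector (4 + 0) ((((4 : ℕ) : ℝ) - ((0 : ℕ) : ℝ)) / 2) :
        Submodule ℂ (Fock (Orb PlaquetteSite))) = szSector 4 2 := by norm_num
    rw [hs, show hamiltonian plaquetteGraph 1 U = plaquetteHamiltonian U from rfl] at h
    linarith
  · have h := le_minEnergyOn_szSector_of_sectorBound plaquetteGraph 1 U _ (a := 0) (b := 4)
      (by rw [card4']; omega) (by rw [card4']) (plaq04_lb hU2)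
    have hs : (szSector (0 + 4) ((((0 : ℕ) : ℝ) - ((4 : ℕ) : ℝ)) / 2) :
        Submodule ℂ (Fock (Orb PlaquetteSite))) = szSector 4 (-2) := by norm_num
    rw [hs, show hamiltonian plaquetteGraph 1 U = plaquetteHamiltonian U from rfl] at h
    linarith

/-- **(W5, charge 2)**: `e(2, 0) < e(2, ±1)`, `U ∈ [2, 4]`: two parallel spins sit at `≥ -5/2` (the new floor
`plaq20s_lb`, `plaq02s_lb`; the truth is `-2`), while `e(2,0) ≤ ē₂(U) < -3.37`. Tsai–Kivelson 2006, Table I.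
[folklore] -/
theorem plaquette_pair_below (hU2 : 2 ≤ U) (hU4 : U ≤ 4) :
    ∀ m : ℝ, m = 1 ∨ m = -1 →
      (plaquetteHamiltonian U).minEnergyOn (szSector 2 0) < (plaquetteHamiltonian U).minEnergyOn (szSector 2 m) := by
  have he2 := e2_le_0 U
  intro m hm
  rcases hm with rfl | rfl
  · have h := le_minEnergyOn_szSector_of_sectorBound plaquetteGraph 1 U _ (a := 2) (b := 0)
      (by rw [card4']; omega) (by rw [card4']; omega) (plaq20s_lb hU2)
    have hs : (szSector (2 + 0) ((((2 : ℕ) : ℝ) - ((0 : ℕ) : ℝ)) / 2) :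
        Submodule ℂ (Fock (Orb PlaquetteSite))) = szSector 2 1 := by norm_num
    rw [hs, show hamiltonian plaquetteGraph 1 U = plaquetteHamiltonian U from rfl] at h
    linarith
  · have h := le_minEnergyOn_szSector_of_sectorBound plaquetteGraph 1 U _ (a := 0) (b := 2)
      (by rw [card4']; omega) (by rw [card4']; omega) (plaq02s_lb hU2)
    have hs : (szSector (0 + 2) ((((0 : ℕ) : ℝ) - ((2 : ℕ) : ℝ)) / 2) :
        Submodule ℂ (Fock (Orb PlaquetteSite))) = szSector 2 (-1) := by norm_num
    rw [hs, show hamiltonian plaquetteGraph 1 U = plaquetteHamiltonian U from rfl] at h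
    linarith

/-! ### Stub 1 modulo (W1): `PlaquetteData U` from the Kato-kernel window -/

/-- **`PlaquetteData U` for `U ∈ [2, 4]`, GIVEN THE KATO-KERNEL WINDOW (W1).** The conclusion is the body of
`PlaquetteData U` of `Cruxes/DressHalfFilled/Lines/birth.lean` / `Cruxes/DressAnyFilling/Lines/birth.lean` written out
verbatim (seven clauses); the hypotheses are its clause (W1) — `0 < J(U)`, `0 ≤ V(U) < 2J(U)` for the second-order
pair-boson couplings `plaquettePairCouplings U` — which is the only clause NOT certified here (it requires a
certified evaluation of the two-plaquette Kato kernel `plaquetteKernel U`; uncertified ED: `V/2J = 0.993` at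
`U = 2`, `< 1` exactly for `U < U_s ≈ 2.7`, Yao–Tsai–Kivelson 2007, p. 4). Clauses (W2)–(W5) are
`plaquette_c_pos`, `plaquette_pairBinding_pos`, `plaquette_pairExclusion_pos`, `plaquette_chordCondition`,
`plaquette_vacuumGS_unique`, `plaquette_pairGS_unique`, `plaquette_vacuum_below`, `plaquette_pair_below`.
[folklore] -/
theorem plaquetteData_of_kernelWindow (hU : U ∈ Set.Icc (2 : ℝ) 4)
    (hJ : 0 < (plaquettePairCouplings U).J) (hV0 : 0 ≤ (plaquettePairCouplings U).V)
    (hV : (plaquettePairCouplings U).V < 2 * (plaquettePairCouplings U).J) :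
    (0 < (plaquettePairCouplings U).J ∧ 0 ≤ (plaquettePairCouplings U).V ∧
        (plaquettePairCouplings U).V < 2 * (plaquettePairCouplings U).J) ∧
    0 < (plaquettePairCouplings U).c ∧
    (0 < (plaquettePairCouplings U).pairBinding ∧ 0 < (plaquettePairCouplings U).pairExclusion ∧
      ∀ n : ℕ, n ≤ 8 → n ≠ 2 → n ≠ 4 →
        (4 - (n : ℝ)) * groundEnergyAt plaquetteGraph 1 U 2 + ((n : ℝ) - 2) * groundEnergyAt plaquetteGraph 1 U 4 <
          2 * groundEnergyAt plaquetteGraph 1 U n) ∧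
    (∀ φ₁ φ₂ : Fock (Orb PlaquetteSite), IsGroundStateInSector (plaquetteHamiltonian U) 4 0 φ₁ →
      IsGroundStateInSector (plaquetteHamiltonian U) 4 0 φ₂ → ∃ a : ℂ, φ₂ = a • φ₁) ∧
    (∀ φ₁ φ₂ : Fock (Orb PlaquetteSite), IsGroundStateInSector (plaquetteHamiltonian U) 2 0 φ₁ →
      IsGroundStateInSector (plaquetteHamiltonian U) 2 0 φ₂ → ∃ a : ℂ, φ₂ = a • φ₁) ∧
    (∀ m : ℝ, m = 1 ∨ m = -1 ∨ m = 2 ∨ m = -2 →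
      (plaquetteHamiltonian U).minEnergyOn (szSector 4 0) < (plaquetteHamiltonian U).minEnergyOn (szSector 4 m)) ∧
    (∀ m : ℝ, m = 1 ∨ m = -1 →
      (plaquetteHamiltonian U).minEnergyOn (szSector 2 0) < (plaquetteHamiltonian U).minEnergyOn (szSector 2 m)) :=
  ⟨⟨hJ, hV0, hV⟩, plaquette_c_pos hU,
    ⟨plaquette_pairBinding_pos hU.1 hU.2, plaquette_pairExclusion_pos hU.1 hU.2, plaquette_chordCondition hU.1 hU.2⟩,
    plaquette_vacuumGS_unique hU, plaquette_pairGS_unique hU, plaquette_vacuum_below hU.1 hU.2,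
    plaquette_pair_below hU.1 hU.2⟩

end Plaquette

/-- **Stub 1 modulo (W1), existential form.** IF the Kato-kernel window holds at SOME `U ∈ [2, 4]`
(`0 < J(U)`, `0 ≤ V(U) < 2J(U)`), THEN `∃ U > 0, PlaquetteData U` — literally the registered stub
`stub_plaquetteData` of `Cruxes/DressHalfFilled/Lines/birth.lean` (and `stub_kineticGlueInWindow` of
`Cruxes/DressAnyFilling/Lines/birth.lean`) with `PlaquetteData` unfolded. What remains of stub 1 is exactly its
clause (W1): a certified evaluation of the second-order two-plaquette kernel. [folklore] -/
theorem stub_plaquetteData_of_kernelWindow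
    (hW : ∃ U ∈ Set.Icc (2 : ℝ) 4, 0 < (plaquettePairCouplings U).J ∧ 0 ≤ (plaquettePairCouplings U).V ∧
      (plaquettePairCouplings U).V < 2 * (plaquettePairCouplings U).J) :
    ∃ U : ℝ, 0 < U ∧
      ((0 < (plaquettePairCouplings U).J ∧ 0 ≤ (plaquettePairCouplings U).V ∧
          (plaquettePairCouplings U).V < 2 * (plaquettePairCouplings U).J) ∧
      0 < (plaquettePairCouplings U).c ∧
      (0 < (plaquettePairCouplings U).pairBinding ∧ 0 < (plaquettePairCouplings U).pairExclusion ∧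
        ∀ n : ℕ, n ≤ 8 → n ≠ 2 → n ≠ 4 →
          (4 - (n : ℝ)) * groundEnergyAt plaquetteGraph 1 U 2 + ((n : ℝ) - 2) * groundEnergyAt plaquetteGraph 1 U 4 <
            2 * groundEnergyAt plaquetteGraph 1 U n) ∧
      (∀ φ₁ φ₂ : Fock (Orb PlaquetteSite), IsGroundStateInSector (plaquetteHamiltonian U) 4 0 φ₁ →
        IsGroundStateInSector (plaquetteHamiltonian U) 4 0 φ₂ → ∃ a : ℂ, φ₂ = a • φ₁) ∧
      (∀ φ₁ φ₂ : Fock (Orb PlaquetteSite), IsGroundStateInSector (plaquetteHamiltonian U) 2 0 φ₁ →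
        IsGroundStateInSector (plaquetteHamiltonian U) 2 0 φ₂ → ∃ a : ℂ, φ₂ = a • φ₁) ∧
      (∀ m : ℝ, m = 1 ∨ m = -1 ∨ m = 2 ∨ m = -2 →
        (plaquetteHamiltonian U).minEnergyOn (szSector 4 0) < (plaquetteHamiltonian U).minEnergyOn (szSector 4 m)) ∧
      (∀ m : ℝ, m = 1 ∨ m = -1 →
        (plaquetteHamiltonian U).minEnergyOn (szSector 2 0) < (plaquetteHamiltonian U).minEnergyOn (szSector 2 m))) := by
  obtain ⟨U, hU, hJ, hV0, hV⟩ := hW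
  exact ⟨U, by linarith [hU.1], plaquetteData_of_kernelWindow hU hJ hV0 hV⟩

/-! ### Registered sub-goal of the crux item (stmt-HubbardSuperconductivity-8148) -/

set_option linter.style.longLine false in
/-- Registered sub-goal `dressHalfFilled_plaquetteDataOfKernelWindow` of the crux item: `PlaquetteData U` (body verbatim) for
`U ∈ [2, 4]` from the Kato-kernel window (W1) (closed restatement of `plaquetteData_of_kernelWindow`). [folklore] -/
theorem dressHalfFilled_plaquetteDataOfKernelWindow : ∀ {U : ℝ}, U ∈ Set.Icc (2 : ℝ) 4 → 0 < (Literature.MathematicalPhysics.QuantumLattice.plaquettePairCouplings U).J → 0 ≤ (Literature.MathematicalPhysics.QuantumLattice.plaquettePairCouplings U).V → (Literature.MathematicalPhysics.QuantumLattice.plaquettePairCouplings U).V < 2 * (Literature.MathematicalPhysics.QuantumLattice.plaquettePairCouplings U).J → (0 < (Literature.MathematicalPhysics.QuantumLattice.plaquettePairCouplings U).J ∧ 0 ≤ (Literature.MathematicalPhysics.QuantumLattice.plaquettePairCouplings U).V ∧ (Literature.MathematicalPhysics.QuantumLattice.plaquettePairCouplings U).V < 2 * (Literature.MathematicalPhysics.QuantumLattice.plaquettePairCouplings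 U).J) ∧ 0 < (Literature.MathematicalPhysics.QuantumLattice.plaquettePairCouplings U).c ∧ (0 < (Literature.MathematicalPhysics.QuantumLattice.plaquettePairCouplings U).pairBinding ∧ 0 < (Literature.MathematicalPhysics.QuantumLattice.plaquettePairCouplings U).pairExclusion ∧ ∀ n : ℕ, n ≤ 8 → n ≠ 2 → n ≠ 4 → (4 - (n : ℝ)) * Literature.MathematicalPhysics.QuantumLattice.groundEnergyAt Literature.MathematicalPhysics.QuantumLattice.plaquetteGraph 1 U 2 + ((n : ℝ) - 2) * Literature.MathematicalPhysics.QuantumLattice.groundEnergyAt Literature.MathematicalPhysics.QuantumLattice.plaquetteGraph 1 U 4 < 2 * Literature.MathematicalPhysics.QuantumLattice.groundEnergyAt Literature.MathematicalPhysics.QuantumLattice.plaquetteGraph 1 U n) ∧ (∀ φ₁ φ₂ : Literature.MathematicalPhysics.QuantumLattice.Fock (Literature.MathematicalPhysics.QuantumLattice.Orb Literature.MathematicalPhysics.QuantumLattice.PlaquetteSite), Literature.MathematicalPhysics.QuantumLattice.IsGroundStateInSector (Literature.MathematicalPhysics.QuantumLattice.plaquetteHamiltonian U) 4 0 φ₁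 → Literature.MathematicalPhysics.QuantumLattice.IsGroundStateInSector (Literature.MathematicalPhysics.QuantumLattice.plaquetteHamiltonian U) 4 0 φ₂ → ∃ a : ℂ, φ₂ = a • φ₁) ∧ (∀ φ₁ φ₂ : Literature.MathematicalPhysics.QuantumLattice.Fock (Literature.MathematicalPhysics.QuantumLattice.Orb Literature.MathematicalPhysics.QuantumLattice.PlaquetteSite), Literature.MathematicalPhysics.QuantumLattice.IsGroundStateInSector (Literature.MathematicalPhysics.QuantumLattice.plaquetteHamiltonian U) 2 0 φ₁ → Literature.MathematicalPhysics.QuantumLattice.IsGroundStateInSector (Literature.MathematicalPhysics.QuantumLattice.plaquetteHamiltonian U) 2 0 φ₂ → ∃ a : ℂ, φ₂ = a • φ₁) ∧ (∀ m : ℝ, m = 1 ∨ m = -1 ∨ m = 2 ∨ m = -2 → (Literature.MathematicalPhysics.QuantumLattice.plaquetteHamiltonian U).minEnergyOn (Literature.MathematicalPhysics.QuantumLattice.szSector 4 0) < (Literature.MathematicalPhysics.QuantumLattice.plaquetteHamiltonian U).minEnergyOn (Literature.MathematicalPhysics.QuantumLattice.szSector 4 m)) ∧ (∀ m : ℝ,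 m = 1 ∨ m = -1 → (Literature.MathematicalPhysics.QuantumLattice.plaquetteHamiltonian U).minEnergyOn (Literature.MathematicalPhysics.QuantumLattice.szSector 2 0) < (Literature.MathematicalPhysics.QuantumLattice.plaquetteHamiltonian U).minEnergyOn (Literature.MathematicalPhysics.QuantumLattice.szSector 2 m)) :=
  fun hU hJ hV0 hV => plaquetteData_of_kernelWindow hU hJ hV0 hV

end Summit.HubbardSuperconductivity.HubbardSuperconductivity.Theorems.LevyLogBootstrap

end
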